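import Summits.QuantumFields.YangMills.Theorems.AllWindowsColdBoxBoxHighLineWickPairCubicColdBox
import Summits.QuantumFields.YangMills.Theorems.AllWindowsColdBoxBoxHighLineLinCurvSqCentredForm
import Summits.QuantumFields.YangMills.Theorems.AllWindowsColdBoxBoxHighLineTripleFormExpansion
import Summits.QuantumFields.YangMills.Theorems.AllWindowsColdBoxBoxHighLinePlaquettePairSums
import Summits.QuantumFields.YangMills.Theorems.AllWindowsColdBoxBoxHighLineEdgeChartHyper

/-!
# K3′ ROW E2 (odd row), E₀-EXACT CORE — `E₀[c^{odd,(3)}_x · L̃_q · P]` summed over the two monomial expansions and over the cubic vertex, UNIFORM in `x, q`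
# (planner ym-idea-2 g18's ruling 2026-08-30T01:12:48Z «E2-odd + β-letter sums → w5»; fcl-p3 g27's hK3 row-sum takes it as a named hypothesis;
#  `Cruxes/BoxWindowHighSU2213/ASSEMBLY-U5.md` §3 «f′(0), the cubic vertex (odd)», blocker B4; LINE-20 U5 ⟨stmt-QuantumFields-24336⟩)

Width seat `ym-line-sfw-p2-w5` (prover-ym-line-sfw-p2-w5-g24-0).  w3 g41's per-monomial-pair cold-box size ✓`WickPairCubic.abs_gaussAvg_centredLandauForm_mul_three_mul_three_le`
(`|E₀[L̃_q·mono_x·mono_{x′}]| ≤ β⁻⁴·C·(1+log H)⁴/((1+d(x,q))³(1+d(x′,q))³(1+d(x,x′))⁴)`, two gradient lines + two cross propagators) is summed here over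

* the two cubic-MONOMIAL expansions ✓`EdgeChartGaussian.tripleForm_plaqVar_expansion` (`Σ|cA| ≤ 384·B`, colour-distinct legs on the plaquette edges) of
  `tripleForm T₀ (plaqVar_x ·)` (the cubic Taylor term of `c_x^{odd}`, ✓7a) and of `tripleForm (Tc p′) (plaqVar_{p′} ·)` (one term of the cubic vertex `P`),
  with the bridge ✓`Cum3Triangle.linCurvSq_sub_gaussAvg_eq_centredForm` (`L̃_q = Σ_{bb′} L_{bb′}(a_ba_{b′} − S_{bb′})`):
  ★ `abs_gaussAvg_tripleForm_mul_centredLinCurvSq_mul_tripleForm_le` (E2a, per plaquette pair);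
* the vertex plaquettes `p′ ∈ plaquettesTouching (boxEdges 4 (2H+1))` with the factor `β` (✓`PlaqSums.plaquetteCentreSums` (i): `Σ_{p′}(1+d(p′,x))⁻⁴ ≤ C(1+log H)`):
  ★★ `abs_gaussAvg_tripleForm_mul_centredLinCurvSq_mul_tripleFormSum_le` (E2b): for `H ≥ 1`, `β > 0`, `|T₀| ≤ B₀`, `|Tc p| ≤ B`, all `q, x, μ, ν`,
  `|E₀[tripleForm T₀(plaqVar_x) · (linCurvSq_q − E₀linCurvSq_q) · (β·Σ_{p′} tripleForm (Tc p′)(plaqVar_{p′}))]| ≤ C·B₀·B·(1+log H)⁵·β⁻¹^3` — UNIFORM in `x, q`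
  (relative to the floor `40e/H⁸·β⁻²`: `H⁸(1+log H)⁵/β`, small iff `8θ < 1`; the `(1+d)`-decay version is not needed).

Generic letters `∀ T₀ B₀, ∀ Tc B` (sign-convention immune); no `D′`, no parity: this is the E₀-EXACT core of the odd row — the `c^{odd} − tripleForm` remainder (`≤ C·s⁵`, ✓7a)
and the `μ_{D′} ↔ E₀` transfer (`√τ`, ✓`GaussRestrict.abs_tiltCum3_muSet_zero_sub_gaussCum3_le`) are fcl-p3 g27's split/Hölder rows.  Tree only; no definitions; standard axioms.
HONEST LABEL: U5 prep, helper-grade (one row of hK3′); U5 ⟨24336⟩ UNSTAFFED/OPEN, ⟨24004⟩ OPEN; route AllWindowsColdBox DRAFT; no crux, rung or summit is proved;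
**the Yang–Mills mass gap is NOT proved by this file; no summit is proved by a line.**
-/

set_option autoImplicit false

noncomputable section

open MeasureTheory Matrix Finset
open Literature.Probability.LatticeModels (Site)
open Literature.MathematicalPhysics.QuantumLattice (ZdPlaquette plaquettesTouching)
open Literature.MathematicalPhysics.QuantumFieldTheory (Plaq)
open Literature.MathematicalPhysics.QuantumFieldTheory.AxialGauge (boxEdges)

namespace Summit.QuantumFields.YangMills.Theorems.AllWindowsColdBoxBoxHighLine

namespace EdgeChartGaussian

open LaplaceSandwich (flatten)

variable {H : ℕ}

/-! ## §1 Certificates -/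

/-- A cubic monomial in the flat coordinates is a certified polynomial of degree `≤ 3`. -/
theorem polyCert_prod_three (l : Fin 3 → LandauFree H × Fin 3) :
    ∃ Q : MvPolynomial (LandauFree H × Fin 3) ℝ, Q.totalDegree ≤ 3 ∧ ∀ a : LandauFree H → E3,
      (∏ s : Fin 3, a (l s).1 (l s).2) = MvPolynomial.eval (flatten (LandauFree H) a) Q := by
  have h := polyCert_mul (polyCert_mul (polyCert_coord (l 0).1 (l 0).2 le_rfl) (polyCert_coord (l 1).1 (l 1).2 le_rfl))
    (polyCert_coord (l 2).1 (l 2).2 le_rfl)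
  obtain ⟨Q, hQ, hQ'⟩ := h
  exact ⟨Q, hQ, fun a => by rw [Fin.prod_univ_three]; exact hQ' a⟩

/-- `tripleForm T (plaqVar H x μ ν ·)` is a certified polynomial of degree `≤ 3`. -/
theorem polyCert_tripleForm (x : Site 4) (μ ν : Fin 4) (T : Fin 4 → Fin 4 → Fin 4 → ℝ) {B : ℝ} (hT : ∀ i j k, |T i j k| ≤ B) :
    ∃ Q : MvPolynomial (LandauFree H × Fin 3) ℝ, Q.totalDegree ≤ 3 ∧ ∀ a : LandauFree H → E3,
      tripleForm T (plaqVar H x μ ν a) = MvPolynomial.eval (flatten (LandauFree H) a) Q := by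
  classical
  obtain ⟨K, _, cA, leg, -, -, -, hexp⟩ := tripleForm_plaqVar_expansion H x μ ν T hT
  obtain ⟨Q, hQ, hQ'⟩ := polyCert_sum (Finset.univ : Finset K) (F := fun k a => cA k * ∏ s : Fin 3, a (leg k s).1 (leg k s).2)
    fun k _ => polyCert_const_mul (cA k) (polyCert_prod_three (leg k))
  exact ⟨Q, hQ, fun a => by rw [hexp a]; exact hQ' a⟩

/-! ## §2 E2a: one plaquette pair -/

/-- ★ **E2a — per plaquette pair, E₀-exact**: for `H ≥ 1`, `β > 0`, `|T₀| ≤ B₀`, `|T′| ≤ B′`, any plaquette `q` and base points/planes of the two cubic forms,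
`|E₀[tripleForm T₀(plaqVar_x) · (linCurvSq_q − E₀ linCurvSq_q) · tripleForm T′(plaqVar_{x′})]| ≤ (384B₀)(384B′)·β⁻⁴·C·(1+log H)⁴/((1+d(x,q))³(1+d(x′,q))³(1+d(x,x′))⁴)`. -/
theorem abs_gaussAvg_tripleForm_mul_centredLinCurvSq_mul_tripleForm_le : ∃ C : ℝ, 0 ≤ C ∧ ∀ H : ℕ, 1 ≤ H → ∀ β : ℝ, 0 < β →
    ∀ B₀ B' : ℝ, ∀ T₀ T' : Fin 4 → Fin 4 → Fin 4 → ℝ, (∀ i j k, |T₀ i j k| ≤ B₀) → (∀ i j k, |T' i j k| ≤ B') →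
    ∀ q : Plaq 4, ∀ x x' : Site 4, ∀ μ ν μ' ν' : Fin 4,
    |gaussAvg β H (fun a => tripleForm T₀ (plaqVar H x μ ν a) * (linCurvSq H q a - gaussAvg β H (linCurvSq H q)) * tripleForm T' (plaqVar H x' μ' ν' a))| ≤
      (384 * B₀) * (384 * B') * (β⁻¹ ^ 4 * (C * (1 + Real.log H) ^ 4 /
        ((1 + siteDist x q.1) ^ 3 * (1 + siteDist x' q.1) ^ 3 * (1 + siteDist x x') ^ 4))) := by
  obtain ⟨C, hC0, hpair⟩ := WickPairCubic.abs_gaussAvg_centredLandauForm_mul_three_mul_three_le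
  refine ⟨C, hC0, fun H hH β hβ B₀ B' T₀ T' hT₀ hT' q x x' μ ν μ' ν' => ?_⟩
  classical
  -- the two-point function and the Landau form of `q`
  obtain ⟨S, hS⟩ : ∃ S : LandauFree H × Fin 3 → LandauFree H × Fin 3 → ℝ,
      S = fun i j => (2 * β)⁻¹ * if i.2 = j.2 then (hodgeQ H)⁻¹ i.1 j.1 else 0 := ⟨_, rfl⟩
  obtain ⟨L, hL⟩ : ∃ L : LandauFree H × Fin 3 → LandauFree H × Fin 3 → ℝ,
      L = fun i j => if i.2 = j.2 then landauCoeff H q i.1 * landauCoeff H q j.1 else 0 := ⟨_, rfl⟩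
  have hS' : ∀ i j, S i j = (2 * β)⁻¹ * if i.2 = j.2 then (hodgeQ H)⁻¹ i.1 j.1 else 0 := fun i j => by rw [hS]
  have hL' : ∀ i j, L i j = if i.2 = j.2 then landauCoeff H q i.1 * landauCoeff H q j.1 else 0 := fun i j => by rw [hL]
  have hF : ∀ a, linCurvSq H q a - gaussAvg β H (linCurvSq H q) = ∑ b, ∑ b', L b b' * (a b.1 b.2 * a b'.1 b'.2 - S b b') :=
    Cum3Triangle.linCurvSq_sub_gaussAvg_eq_centredForm H hβ q S L hS' hL'
  -- the two monomial expansions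
  obtain ⟨KA, _, cA, lA, hsA, hcA, heA, hexpA⟩ := tripleForm_plaqVar_expansion H x μ ν T₀ hT₀
  obtain ⟨KB, _, cB, lB, hsB, hcB, heB, hexpB⟩ := tripleForm_plaqVar_expansion H x' μ' ν' T' hT'
  -- the size per monomial pair
  obtain ⟨R, hR⟩ : ∃ R : ℝ, R = β⁻¹ ^ 4 * (C * (1 + Real.log H) ^ 4 /
      ((1 + siteDist x q.1) ^ 3 * (1 + siteDist x' q.1) ^ 3 * (1 + siteDist x x') ^ 4)) := ⟨_, rfl⟩
  have hR0 : 0 ≤ R := by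
    have h1 := GhostKernel.siteDist_nonneg x q.1
    have h2 := GhostKernel.siteDist_nonneg x' q.1
    have h3 := GhostKernel.siteDist_nonneg x x'
    have hL0 : 0 ≤ 1 + Real.log (H : ℝ) := by
      have : (1 : ℝ) ≤ H := by exact_mod_cast hH
      have := Real.log_nonneg this; linarith
    rw [hR]; positivity
  have hterm : ∀ k l, |cA k * cB l * gaussAvg β H (fun a => (linCurvSq H q a - gaussAvg β H (linCurvSq H q)) *
      (∏ s : Fin 3, a (lA k s).1 (lA k s).2) * (∏ s : Fin 3, a (lB l s).1 (lB l s).2))| ≤ |cA k| * |cB l| * R := by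
    intro k l
    by_cases hk : cA k = 0
    · rw [hk]; simp only [zero_mul, abs_zero]; positivity
    by_cases hl : cB l = 0
    · rw [hl]; simp only [mul_zero, zero_mul, abs_zero]; positivity
    rw [abs_mul, abs_mul]
    refine mul_le_mul_of_nonneg_left ?_ (by positivity)
    have e : (fun a : LandauFree H → E3 => (linCurvSq H q a - gaussAvg β H (linCurvSq H q)) *
        (∏ s : Fin 3, a (lA k s).1 (lA k s).2) * (∏ s : Fin 3, a (lB l s).1 (lB l s).2)) =
        fun a => (∑ b, ∑ b', L b b' * (a b.1 b.2 * a b'.1 b'.2 - S b b')) *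
          (a (lA k 0).1 (lA k 0).2 * a (lA k 1).1 (lA k 1).2 * a (lA k 2).1 (lA k 2).2) *
          (a (lB l 0).1 (lB l 0).2 * a (lB l 1).1 (lB l 1).2 * a (lB l 2).1 (lB l 2).2) := by
      funext a; rw [hF a, Fin.prod_univ_three, Fin.prod_univ_three]
    rw [e, hR]
    have hvA : ∀ s : Fin 3, (![lA k 0, lA k 1, lA k 2] : Fin 3 → LandauFree H × Fin 3) s = lA k s := fun s => by
      fin_cases s <;> rfl
    have hvB : ∀ s : Fin 3, (![lB l 0, lB l 1, lB l 2] : Fin 3 → LandauFree H × Fin 3) s = lB l s := fun s => by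
      fin_cases s <;> rfl
    exact hpair H hH β hβ q S L hS' hL' x x' μ ν μ' ν' (lA k 0) (lA k 1) (lA k 2) (lB l 0) (lB l 1) (lB l 2)
      (hcA k 0 1 (by decide)) (hcA k 0 2 (by decide)) (hcA k 1 2 (by decide))
      (hcB l 0 1 (by decide)) (hcB l 0 2 (by decide)) (hcB l 1 2 (by decide))
      (fun s => by rw [hvA]; exact heA k hk s) (fun s => by rw [hvB]; exact heB l hl s)
  -- linearity
  have hint : ∀ k l, Integrable fun a : LandauFree H → E3 => (linCurvSq H q a - gaussAvg β H (linCurvSq H q)) *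
      (∏ s : Fin 3, a (lA k s).1 (lA k s).2) * (∏ s : Fin 3, a (lB l s).1 (lB l s).2) * gaussWeight β H a := fun k l =>
    integrable_polyCert_mul_gaussWeight H hβ (polyCert_mul (polyCert_mul (polyCert_sub (polyCert_linCurvSq H q) (polyCert_const _ 2))
      (polyCert_prod_three (lA k))) (polyCert_prod_three (lB l)))
  have hpt : (fun a => tripleForm T₀ (plaqVar H x μ ν a) * (linCurvSq H q a - gaussAvg β H (linCurvSq H q)) * tripleForm T' (plaqVar H x' μ' ν' a)) =
      fun a => ∑ k, ∑ l, cA k * cB l * ((linCurvSq H q a - gaussAvg β H (linCurvSq H q)) *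
        (∏ s : Fin 3, a (lA k s).1 (lA k s).2) * (∏ s : Fin 3, a (lB l s).1 (lB l s).2)) := by
    funext a
    rw [hexpA a, hexpB a, Finset.sum_mul, Finset.sum_mul]
    refine Finset.sum_congr rfl fun k _ => ?_
    rw [Finset.mul_sum]
    exact Finset.sum_congr rfl fun l _ => by ring
  rw [hpt, gaussAvg_finset_sum β H _ _ fun k _ => ?_]
  swap
  · refine (integrable_finsetSum Finset.univ fun l _ => (hint k l).const_mul (cA k * cB l)).congr (Filter.Eventually.of_forall fun a => ?_)
    simp only [Finset.sum_mul]
    exact Finset.sum_congr rfl fun l _ => by ring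
  have hinner : ∀ k, gaussAvg β H (fun a => ∑ l, cA k * cB l * ((linCurvSq H q a - gaussAvg β H (linCurvSq H q)) *
      (∏ s : Fin 3, a (lA k s).1 (lA k s).2) * (∏ s : Fin 3, a (lB l s).1 (lB l s).2))) =
      ∑ l, cA k * cB l * gaussAvg β H (fun a => (linCurvSq H q a - gaussAvg β H (linCurvSq H q)) *
        (∏ s : Fin 3, a (lA k s).1 (lA k s).2) * (∏ s : Fin 3, a (lB l s).1 (lB l s).2)) := by
    intro k
    rw [gaussAvg_finset_sum β H _ _ fun l _ => ((hint k l).const_mul (cA k * cB l)).congr (Filter.Eventually.of_forall fun a => by ring)]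
    exact Finset.sum_congr rfl fun l _ => gaussAvg_const_mul β H _ _
  simp only [hinner]
  -- sum the per-term sizes
  have hB₀ : 0 ≤ B₀ := (abs_nonneg _).trans (hT₀ 0 0 0)
  have hB' : 0 ≤ B' := (abs_nonneg _).trans (hT' 0 0 0)
  calc |∑ k, ∑ l, cA k * cB l * gaussAvg β H (fun a => (linCurvSq H q a - gaussAvg β H (linCurvSq H q)) *
        (∏ s : Fin 3, a (lA k s).1 (lA k s).2) * (∏ s : Fin 3, a (lB l s).1 (lB l s).2))|
      ≤ ∑ k, ∑ l, |cA k| * |cB l| * R := by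
        refine (Finset.abs_sum_le_sum_abs _ _).trans (Finset.sum_le_sum fun k _ => ?_)
        exact (Finset.abs_sum_le_sum_abs _ _).trans (Finset.sum_le_sum fun l _ => hterm k l)
    _ = (∑ k, |cA k|) * (∑ l, |cB l|) * R := by
        rw [Finset.sum_mul_sum, Finset.sum_mul]
        exact Finset.sum_congr rfl fun k _ => by rw [Finset.sum_mul]
    _ ≤ (384 * B₀) * (384 * B') * R := by
        have h1 : 0 ≤ ∑ l, |cB l| := Finset.sum_nonneg fun l _ => abs_nonneg _
        exact mul_le_mul_of_nonneg_right (mul_le_mul hsA hsB h1 (by positivity)) hR0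
    _ = _ := by rw [hR]

/-! ## §3 E2b: summed over the cubic vertex, uniform in `x, q` -/

/-- ★★ **E2b — the E₀-exact core of the odd row of `κ₃`, UNIFORM**: for `H ≥ 1`, `β > 0`, `|T₀| ≤ B₀`, `|Tc p| ≤ B`, all `q, x, μ, ν`,
`|E₀[tripleForm T₀(plaqVar_x) · (linCurvSq_q − E₀ linCurvSq_q) · (β·Σ_{p′} tripleForm (Tc p′)(plaqVar_{p′}))]| ≤ C·B₀·B·(1+log H)⁵·β⁻¹^3`. -/
theorem abs_gaussAvg_tripleForm_mul_centredLinCurvSq_mul_tripleFormSum_le : ∃ C : ℝ, 0 ≤ C ∧ ∀ H : ℕ, 1 ≤ H → ∀ β : ℝ, 0 < β →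
    ∀ B₀ B : ℝ, ∀ T₀ : Fin 4 → Fin 4 → Fin 4 → ℝ, (∀ i j k, |T₀ i j k| ≤ B₀) →
    ∀ Tc : ZdPlaquette 4 → Fin 4 → Fin 4 → Fin 4 → ℝ, (∀ p i j k, |Tc p i j k| ≤ B) →
    ∀ q : Plaq 4, ∀ x : Site 4, ∀ μ ν : Fin 4,
    |gaussAvg β H (fun a => tripleForm T₀ (plaqVar H x μ ν a) * (linCurvSq H q a - gaussAvg β H (linCurvSq H q)) *
        (β * ∑ p ∈ plaquettesTouching (boxEdges 4 (2 * H + 1)), tripleForm (Tc p) (plaqVar H p.1 p.2.1.1 p.2.1.2 a)))| ≤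
      C * B₀ * B * (1 + Real.log H) ^ 5 * β⁻¹ ^ 3 := by
  obtain ⟨C, hC0, hpair⟩ := abs_gaussAvg_tripleForm_mul_centredLinCurvSq_mul_tripleForm_le
  obtain ⟨CS, hCS0, hsums⟩ := PlaqSums.plaquetteCentreSums
  refine ⟨384 * 384 * C * CS, by positivity, fun H hH β hβ B₀ B T₀ hT₀ Tc hT q x μ ν => ?_⟩
  classical
  set PT := plaquettesTouching (boxEdges 4 (2 * H + 1)) with hPT
  have hH1 : (1 : ℝ) ≤ H := by exact_mod_cast hH
  have hLg0 : 0 ≤ 1 + Real.log (H : ℝ) := by have := Real.log_nonneg hH1; linarith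
  have hB₀ : 0 ≤ B₀ := (abs_nonneg _).trans (hT₀ 0 0 0)
  have hB : 0 ≤ B := (abs_nonneg _).trans (hT (((0 : Site 4), ⟨(0, 1), by decide⟩) : ZdPlaquette 4) 0 0 0)
  -- per vertex plaquette, with the two `(1+d)⁻³ ≤ 1` dropped and `d(x,p′) = d(p′,x)`
  have hone : ∀ p' : ZdPlaquette 4,
      |gaussAvg β H (fun a => tripleForm T₀ (plaqVar H x μ ν a) * (linCurvSq H q a - gaussAvg β H (linCurvSq H q)) *
        tripleForm (Tc p') (plaqVar H p'.1 p'.2.1.1 p'.2.1.2 a))| ≤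
        (384 * B₀) * (384 * B) * (β⁻¹ ^ 4 * (C * (1 + Real.log H) ^ 4)) * (1 / (1 + siteDist p'.1 x) ^ 4) := by
    intro p'
    refine (hpair H hH β hβ B₀ B T₀ (Tc p') hT₀ (hT p') q x p'.1 μ ν p'.2.1.1 p'.2.1.2).trans ?_
    have h1 : 1 ≤ (1 + siteDist x q.1) ^ 3 := one_le_pow₀ (by linarith [GhostKernel.siteDist_nonneg x q.1])
    have h2 : 1 ≤ (1 + siteDist p'.1 q.1) ^ 3 := one_le_pow₀ (by linarith [GhostKernel.siteDist_nonneg p'.1 q.1])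
    have h4 : 0 < (1 + siteDist x p'.1) ^ 4 := by have := GhostKernel.siteDist_nonneg x p'.1; positivity
    rw [siteDist_comm p'.1 x]
    have hnum : 0 ≤ C * (1 + Real.log (H : ℝ)) ^ 4 := by positivity
    have hfrac : C * (1 + Real.log (H : ℝ)) ^ 4 / ((1 + siteDist x q.1) ^ 3 * (1 + siteDist p'.1 q.1) ^ 3 * (1 + siteDist x p'.1) ^ 4) ≤
        C * (1 + Real.log (H : ℝ)) ^ 4 * (1 / (1 + siteDist x p'.1) ^ 4) := by
      rw [mul_one_div]
      exact div_le_div_of_nonneg_left hnum h4 (by nlinarith [h4.le, one_le_mul_of_one_le_of_one_le h1 h2])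
    have hc : 0 ≤ (384 * B₀) * (384 * B) * β⁻¹ ^ 4 := by positivity
    calc (384 * B₀) * (384 * B) * (β⁻¹ ^ 4 * (C * (1 + Real.log H) ^ 4 /
          ((1 + siteDist x q.1) ^ 3 * (1 + siteDist p'.1 q.1) ^ 3 * (1 + siteDist x p'.1) ^ 4)))
        = (384 * B₀) * (384 * B) * β⁻¹ ^ 4 * (C * (1 + Real.log H) ^ 4 /
          ((1 + siteDist x q.1) ^ 3 * (1 + siteDist p'.1 q.1) ^ 3 * (1 + siteDist x p'.1) ^ 4)) := by ring
      _ ≤ (384 * B₀) * (384 * B) * β⁻¹ ^ 4 * (C * (1 + Real.log H) ^ 4 * (1 / (1 + siteDist x p'.1) ^ 4)) := mul_le_mul_of_nonneg_left hfrac hc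
      _ = _ := by ring
  -- linearity over the vertex sum
  have hcT0 := polyCert_tripleForm (H := H) x μ ν T₀ hT₀
  have hint : ∀ p' : ZdPlaquette 4, Integrable fun a : LandauFree H → E3 => tripleForm T₀ (plaqVar H x μ ν a) *
      (linCurvSq H q a - gaussAvg β H (linCurvSq H q)) * tripleForm (Tc p') (plaqVar H p'.1 p'.2.1.1 p'.2.1.2 a) * gaussWeight β H a := fun p' =>
    integrable_polyCert_mul_gaussWeight H hβ (polyCert_mul (polyCert_mul hcT0 (polyCert_sub (polyCert_linCurvSq H q) (polyCert_const _ 2)))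
      (polyCert_tripleForm (H := H) p'.1 p'.2.1.1 p'.2.1.2 (Tc p') (hT p')))
  have hpt : (fun a => tripleForm T₀ (plaqVar H x μ ν a) * (linCurvSq H q a - gaussAvg β H (linCurvSq H q)) *
      (β * ∑ p ∈ PT, tripleForm (Tc p) (plaqVar H p.1 p.2.1.1 p.2.1.2 a))) =
      fun a => β * ∑ p ∈ PT, tripleForm T₀ (plaqVar H x μ ν a) * (linCurvSq H q a - gaussAvg β H (linCurvSq H q)) *
        tripleForm (Tc p) (plaqVar H p.1 p.2.1.1 p.2.1.2 a) := by
    funext a; rw [Finset.mul_sum, Finset.mul_sum, Finset.mul_sum]; exact Finset.sum_congr rfl fun p _ => by ring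
  rw [hpt, gaussAvg_const_mul, gaussAvg_finset_sum β H PT _ fun p _ => hint p, abs_mul, abs_of_pos hβ]
  have hsum := (hsums H hH x x).1
  calc β * |∑ p ∈ PT, gaussAvg β H (fun a => tripleForm T₀ (plaqVar H x μ ν a) * (linCurvSq H q a - gaussAvg β H (linCurvSq H q)) *
        tripleForm (Tc p) (plaqVar H p.1 p.2.1.1 p.2.1.2 a))|
      ≤ β * ∑ p ∈ PT, (384 * B₀) * (384 * B) * (β⁻¹ ^ 4 * (C * (1 + Real.log H) ^ 4)) * (1 / (1 + siteDist p.1 x) ^ 4) :=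
        mul_le_mul_of_nonneg_left ((Finset.abs_sum_le_sum_abs _ _).trans (Finset.sum_le_sum fun p _ => hone p)) hβ.le
    _ = β * ((384 * B₀) * (384 * B) * (β⁻¹ ^ 4 * (C * (1 + Real.log H) ^ 4)) * ∑ p ∈ PT, 1 / (1 + siteDist p.1 x) ^ 4) := by
        rw [← Finset.mul_sum]
    _ ≤ β * ((384 * B₀) * (384 * B) * (β⁻¹ ^ 4 * (C * (1 + Real.log H) ^ 4)) * (CS * (1 + Real.log H))) :=
        mul_le_mul_of_nonneg_left (mul_le_mul_of_nonneg_left hsum (by positivity)) hβ.le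
    _ = (β * β⁻¹) * (384 * 384 * C * CS * B₀ * B * (1 + Real.log H) ^ 5 * β⁻¹ ^ 3) := by ring
    _ = 384 * 384 * C * CS * B₀ * B * (1 + Real.log H) ^ 5 * β⁻¹ ^ 3 := by rw [mul_inv_cancel₀ hβ.ne', one_mul]

end EdgeChartGaussian

end Summit.QuantumFields.YangMills.Theorems.AllWindowsColdBoxBoxHighLine

end
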